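import Mathlib
import Literature.NumberTheory.LFunctions.Zhang2022.Section15ResidueParams
import HarnessLib

/-!
# Zhang (2022) §15 (15.16) / §16 (16.11): the factors of `ℛ₁ⱼ`, `ℛ₂ⱼ` near `1` — `ζ(1+u)`, `L(1−β,χ)`

Topic `Literature/NumberTheory/LFunctions/Zhang2022` (Landau–Siegel audit tree; verdict-neutral).
Y. Zhang, *Discrete mean estimates and the Landau–Siegel zero*, arXiv:2211.02515v1 (2022)
[Zhang2022LandauSiegel] — **an unrefereed manuscript under adjudication** (cell siegel-zhang, D-0069
width campaign). DISCHARGE file (theorems only; no new definitions, no new facts); no statement about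
Theorems 1–2 of the manuscript or about Landau–Siegel zeros is made or implied.

The quantitative inputs of "by Lemma 5.8 and direct calculation" for the residues `ℛ₁ⱼ` (§15 p. 88,
tex L4380–L4382, DAG `Z22:§15.u059`) and `ℛ₂ⱼ` (§16 p. 95, tex L4674–L4677, DAG `Z22:§16.u043`):
* `zeta_shift_bounds`: on a punctured disc `0 < |u| < r`: `ζ(1+u) ≠ 0`, `|uζ(1+u) − 1| ≤ K|u| ≤ 1/2`
  (Mathlib `riemannZeta₁`);
* `L_one_sub_beta_bounds`: under (A), for all large `D` and every `β` with `α/2 ≤ |β| ≤ 4α`: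
  `L(1−β,χ) ≠ 0` and `|L(1−β,χ)/(−βL′(1,χ)) − 1| ≤ C𝓛⁻⁶ ≤ 1/2` — Lemma 5.8 in the tree's proved form
  `Lemma58.lemma_5_8_of_le` (`L(s,χ) = L′(1,χ)(s−1) + O(𝓛⁻¹⁵)`, `|s−1| ≤ 10α`) divided by
  `|βL′(1,χ)| ≥ (α/2)·c` (`|L′(1,χ)| ≥ c`: Lemma 5.7, tree `Skeleton.lemma57_holds`);
* the sharper parameter sizes `|α log P₄ − π| ≤ 521π𝓛⁻⁷`, `|c′α𝓛| = |c′|π𝓛⁻⁸`, `α/2 ≤ |βₖ| ≤ 4α`;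
* two pieces of "`(1+O(ε))`-algebra": `|x⁻¹ − 1| ≤ 2|x − 1|` and `|xy − 1| ≤ 2|x−1| + |y−1|`.
-/

noncomputable section

open Complex Real Filter Topology

namespace Literature.NumberTheory.LFunctions.Zhang2022.ResidueValues

open Skeleton

/-! ## `(1 + O(ε))`-algebra -/

/-- `|x⁻¹ − 1| ≤ 2|x − 1|` when `|x − 1| ≤ 1/2`. [cite: Zhang2022LandauSiegel, §15 p. 88] -/
theorem norm_inv_sub_one_le {x : ℂ} {t : ℝ} (hx : ‖x - 1‖ ≤ t) (ht : t ≤ 1 / 2) :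
    ‖x⁻¹ - 1‖ ≤ 2 * t := by
  have hx1 : 1 / 2 ≤ ‖x‖ := by
    have h := norm_sub_norm_le (1 : ℂ) x
    rw [norm_one, norm_sub_rev] at h
    linarith
  have hx0 : x ≠ 0 := by
    intro h; rw [h, norm_zero] at hx1; norm_num at hx1
  have hrew : x⁻¹ - 1 = -(x - 1) / x := by field_simp; ring
  rw [hrew, norm_div, norm_neg, div_le_iff₀ (by linarith)]
  nlinarith [norm_nonneg (x - 1)]

/-- `|xy − 1| ≤ 2|x − 1| + |y − 1|` when `|y − 1| ≤ 1`. [cite: Zhang2022LandauSiegel, §15 p. 88] -/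
theorem norm_mul_sub_one_le {x y : ℂ} {s t : ℝ} (hx : ‖x - 1‖ ≤ s) (hy : ‖y - 1‖ ≤ t) (ht : t ≤ 1) :
    ‖x * y - 1‖ ≤ 2 * s + t := by
  have hs : 0 ≤ s := (norm_nonneg _).trans hx
  have hy2 : ‖y‖ ≤ 2 := by
    have h := norm_add_le (y - 1) (1 : ℂ)
    rw [sub_add_cancel, norm_one] at h
    linarith
  have hrew : x * y - 1 = (x - 1) * y + (y - 1) := by ring
  rw [hrew]
  refine (norm_add_le _ _).trans ?_
  rw [norm_mul]
  nlinarith [norm_nonneg (x - 1), norm_nonneg y]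

/-! ## Sharper parameter sizes -/

section Parameters

variable (c' : ℝ) {D : ℕ}

omit c' in
/-- **`|α log P₄ − π| ≤ 521π/𝓛⁷`** (`𝓛 ≥ 3`; `log P₄ = 𝓛⁹ − 2𝓛^{1.1} + 519 log 𝓛`, `𝓛^{1.1}, log 𝓛 ≤ 𝓛²`).
[cite: Zhang2022LandauSiegel, §6 p. 12] -/
theorem abs_alpha_mul_log_P4_sub_pi_le7 (hL : 3 ≤ ell D) :
    |alpha D * Real.log (P4 D) - π| ≤ 521 * π / ell D ^ 7 := by
  have hℓ : 0 < ell D := by linarith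
  have h1 : (1 : ℝ) ≤ ell D := by linarith
  rw [log_P4_eq hL, Section2.alpha_eq_pi_div_ell9]
  have h9 : ell D ^ 9 ≠ 0 := pow_ne_zero _ hℓ.ne'
  have hexpr : π / ell D ^ 9 * (ell D ^ 9 - 2 * ell D ^ (1.1 : ℝ) + 519 * Real.log (ell D)) - π =
      π * (-2 * ell D ^ (1.1 : ℝ) + 519 * Real.log (ell D)) / ell D ^ 9 := by
    field_simp
    ring
  rw [hexpr]
  have hr : ell D ^ (1.1 : ℝ) ≤ ell D ^ 2 := by
    calc ell D ^ (1.1 : ℝ) ≤ ell D ^ (2 : ℝ) := Real.rpow_le_rpow_of_exponent_le h1 (by norm_num)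
      _ = ell D ^ 2 := by norm_cast
  have hr0 : 0 ≤ ell D ^ (1.1 : ℝ) := Real.rpow_nonneg hℓ.le _
  have hlog0 : 0 ≤ Real.log (ell D) := Real.log_nonneg h1
  have hlog : Real.log (ell D) ≤ ell D ^ 2 := by
    calc Real.log (ell D) ≤ ell D := (Real.log_le_sub_one_of_pos hℓ).trans (by linarith)
      _ ≤ ell D ^ 2 := by nlinarith
  have hnum : |π * (-2 * ell D ^ (1.1 : ℝ) + 519 * Real.log (ell D))| ≤ π * (521 * ell D ^ 2) := by
    rw [abs_mul, abs_of_pos Real.pi_pos]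
    refine mul_le_mul_of_nonneg_left ?_ Real.pi_pos.le
    refine abs_le.mpr ⟨?_, ?_⟩ <;> nlinarith
  rw [abs_div, abs_of_pos (pow_pos hℓ 9)]
  calc |π * (-2 * ell D ^ (1.1 : ℝ) + 519 * Real.log (ell D))| / ell D ^ 9
      ≤ π * (521 * ell D ^ 2) / ell D ^ 9 := by gcongr
    _ = 521 * π / ell D ^ 7 := by field_simp

/-- `|c′α𝓛| = |c′|π/𝓛⁸` (`𝓛 ≥ 3`). [cite: Zhang2022LandauSiegel, §2 (2.13)] -/
theorem abs_e_eq (hL : 3 ≤ ell D) : |c' * alpha D * ell D| = |c'| * π / ell D ^ 8 := by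
  have hℓ : 0 < ell D := by linarith
  rw [Section2.alpha_eq_pi_div_ell9, abs_mul, abs_mul, abs_of_pos hℓ, abs_div, abs_of_pos Real.pi_pos,
    abs_of_pos (pow_pos hℓ 9)]
  field_simp

/-- `|β₃| ≤ 4α` when `|e| ≤ 1/14`. [cite: Zhang2022LandauSiegel, §2 (2.13)] -/
theorem norm_beta3_le (hL : 3 ≤ ell D) (he : |c' * alpha D * ell D| ≤ 1 / 14) :
    ‖beta3 c' D‖ ≤ 4 * alpha D := by
  have hα := alpha_pos hL
  have he' := abs_le.mp he
  rw [beta3_eq, norm_mul, Complex.norm_I, one_mul, Complex.norm_real, Real.norm_eq_abs,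
    abs_mul, abs_of_pos hα]
  have habs : |3 - 3 * (c' * alpha D * ell D)| ≤ 4 := abs_le.mpr ⟨by linarith, by linarith⟩
  nlinarith

/-- `α/2 ≤ |β₁|, |β₂|, |β₃|` when `|e| ≤ 1/14`. [cite: Zhang2022LandauSiegel, §2 (2.13)] -/
theorem norm_beta_ge (hL : 3 ≤ ell D) (he : |c' * alpha D * ell D| ≤ 1 / 14) :
    alpha D / 2 ≤ ‖beta1 c' D‖ ∧ alpha D / 2 ≤ ‖beta2 c' D‖ ∧ alpha D / 2 ≤ ‖beta3 c' D‖ := by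
  have hα := alpha_pos hL
  have he' := abs_le.mp he
  refine ⟨?_, ?_, ?_⟩
  · rw [beta1_eq]; exact norm_I_mul_ofReal_ge hα (by rw [le_abs]; left; linarith)
  · rw [beta2_eq]; exact norm_I_mul_ofReal_ge hα (by rw [le_abs]; left; linarith)
  · rw [beta3_eq]; exact norm_I_mul_ofReal_ge hα (by rw [le_abs]; left; linarith)

/-- The differences `βₖ − βⱼ` (`k ≠ j`) have `α/2 ≤ |βₖ − βⱼ| ≤ 8α` when `|e| ≤ 1/14`.
[cite: Zhang2022LandauSiegel, §2 (2.13)] -/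
theorem norm_beta_sub (hL : 3 ≤ ell D) (he : |c' * alpha D * ell D| ≤ 1 / 14) :
    (alpha D / 2 ≤ ‖beta2 c' D - beta1 c' D‖ ∧ ‖beta2 c' D - beta1 c' D‖ ≤ 8 * alpha D) ∧
    (alpha D / 2 ≤ ‖beta3 c' D - beta1 c' D‖ ∧ ‖beta3 c' D - beta1 c' D‖ ≤ 8 * alpha D) ∧
    (alpha D / 2 ≤ ‖beta3 c' D - beta2 c' D‖ ∧ ‖beta3 c' D - beta2 c' D‖ ≤ 8 * alpha D) := by
  have hα := alpha_pos hL
  have he' := abs_le.mp he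
  have h21 : beta2 c' D - beta1 c' D = I * ((alpha D * (1 + 7 * (c' * alpha D * ell D))) : ℝ) := by
    rw [beta1_eq, beta2_eq]; push_cast; ring
  have h31 : beta3 c' D - beta1 c' D = I * ((alpha D * (2 + 2 * (c' * alpha D * ell D))) : ℝ) := by
    rw [beta1_eq, beta3_eq]; push_cast; ring
  have h32 : beta3 c' D - beta2 c' D = I * ((alpha D * (1 - 5 * (c' * alpha D * ell D))) : ℝ) := by
    rw [beta2_eq, beta3_eq]; push_cast; ring
  have up : ∀ r : ℝ, |r| ≤ 8 → ‖I * ((alpha D * r : ℝ) : ℂ)‖ ≤ 8 * alpha D := by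
    intro r hr
    rw [norm_mul, Complex.norm_I, one_mul, Complex.norm_real, Real.norm_eq_abs, abs_mul,
      abs_of_pos hα]
    nlinarith
  refine ⟨⟨?_, ?_⟩, ⟨?_, ?_⟩, ⟨?_, ?_⟩⟩
  · rw [h21]; exact norm_I_mul_ofReal_ge hα (by rw [le_abs]; left; linarith)
  · rw [h21]; exact up _ (abs_le.mpr ⟨by linarith, by linarith⟩)
  · rw [h31]; exact norm_I_mul_ofReal_ge hα (by rw [le_abs]; left; linarith)
  · rw [h31]; exact up _ (abs_le.mpr ⟨by linarith, by linarith⟩)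
  · rw [h32]; exact norm_I_mul_ofReal_ge hα (by rw [le_abs]; left; linarith)
  · rw [h32]; exact up _ (abs_le.mpr ⟨by linarith, by linarith⟩)

end Parameters

/-! ## `ζ(1+u)` for small `u ≠ 0` -/

/-- **`uζ(1+u) = 1 + O(|u|)`**: there are `r > 0`, `K ≥ 0` with `ζ(1+u) ≠ 0`,
`|uζ(1+u) − 1| ≤ K|u|` and `|uζ(1+u) − 1| ≤ 1/2` whenever `0 < |u| < r`.
[cite: Zhang2022LandauSiegel, §15 (15.16) p. 85] -/
theorem zeta_shift_bounds : ∃ r : ℝ, 0 < r ∧ ∃ K : ℝ, 0 ≤ K ∧ ∀ u : ℂ, u ≠ 0 → ‖u‖ < r →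
    riemannZeta (1 + u) ≠ 0 ∧ ‖u * riemannZeta (1 + u) - 1‖ ≤ K * ‖u‖ ∧
      ‖u * riemannZeta (1 + u) - 1‖ ≤ 1 / 2 := by
  -- `ζ₁` is differentiable at `1` with `ζ₁(1) = 1`: `ζ₁(s) − 1 = O(s − 1)` near `1`
  have hd : DifferentiableAt ℂ riemannZeta₁ 1 := differentiable_riemannZeta₁.differentiableAt
  have hO := hd.isBigO_sub
  rw [riemannZeta₁_one] at hO
  obtain ⟨c, hc⟩ := hO.bound
  have hcont : ContinuousAt riemannZeta₁ 1 := hd.continuousAt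
  have hev : ∀ᶠ s in 𝓝 (1 : ℂ), ‖riemannZeta₁ s - 1‖ < 1 / 2 := by
    have h : Tendsto riemannZeta₁ (𝓝 1) (𝓝 1) := by
      have h' := hcont.tendsto; rwa [riemannZeta₁_one] at h'
    have h2 := Metric.tendsto_nhds.mp h (1 / 2) (by norm_num)
    filter_upwards [h2] with s hs
    rwa [dist_eq_norm] at hs
  obtain ⟨r, hr, h⟩ := Metric.eventually_nhds_iff.mp (hc.and hev)
  refine ⟨r, hr, max c 0, le_max_right _ _, fun u hu0 hur => ?_⟩
  have hs1 : (1 : ℂ) + u ≠ 1 := by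
    intro h'; apply hu0; linear_combination h'
  have hdist : dist (1 + u) (1 : ℂ) < r := by
    rw [dist_eq_norm, add_sub_cancel_left]; exact hur
  obtain ⟨h1, h2⟩ := h hdist
  rw [add_sub_cancel_left] at h1
  have hmul : u * riemannZeta (1 + u) = riemannZeta₁ (1 + u) := by
    rw [riemannZeta_eq_inv_sub_mul hs1, add_sub_cancel_left, ← mul_assoc, mul_inv_cancel₀ hu0,
      one_mul]
  rw [hmul]
  refine ⟨?_, h1.trans (by gcongr; exact le_max_left _ _), le_of_lt h2⟩
  intro h0
  have : riemannZeta₁ (1 + u) = 0 := by rw [← hmul, h0, mul_zero]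
  rw [this, zero_sub, norm_neg, norm_one] at h2
  norm_num at h2

/-! ## `L(1−β,χ)` for `|β| ≍ α`, under (A) -/

/-- **`L(1−β,χ) = −βL′(1,χ)(1 + O(𝓛⁻⁶))`** under (A), for all large `D` and every `β` with
`α/2 ≤ |β| ≤ 4α`: `L(1−β,χ) ≠ 0`, `|L(1−β,χ)/(−βL′(1,χ)) − 1| ≤ C𝓛⁻⁶`, and `C𝓛⁻⁶ ≤ 1/2`
(Lemma 5.8 — tree `Lemma58.lemma_5_8_of_le` — over `|βL′(1,χ)| ≥ αc/2`, Lemma 5.7).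
[cite: Zhang2022LandauSiegel, §5 Lemma 5.8] -/
theorem L_one_sub_beta_bounds : ∃ C : ℝ, 0 ≤ C ∧ ForAllLarge fun D _ χ => AssumptionA D χ →
    ∀ β : ℂ, alpha D / 2 ≤ ‖β‖ → ‖β‖ ≤ 4 * alpha D →
      χ.LFunction (1 - β) ≠ 0 ∧
        ‖χ.LFunction (1 - β) / (-β * deriv χ.LFunction 1) - 1‖ ≤ C / ell D ^ 6 ∧
          C / ell D ^ 6 ≤ 1 / 2 := by
  obtain ⟨c, hc, D₀, h57⟩ := norm_deriv_LFunction_one_ge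
  set C₈ : ℝ := 1 + 16 * Real.exp (9 / 2) * π ^ 2 * 10 ^ 2 with hC₈
  have hC₈0 : 0 ≤ C₈ := by positivity
  set C : ℝ := 2 * C₈ / (π * c) with hCdef
  have hC0 : 0 ≤ C := by positivity
  refine ⟨C, hC0, max D₀ (max ⌈Real.exp 3⌉₊ ⌈Real.exp (2 * C + 1)⌉₊), fun D _ χ hD hq hp hA β hβl hβu => ?_⟩
  have hD₀ : D₀ ≤ D := le_trans (le_max_left _ _) hD
  have hL : 3 ≤ ell D :=
    three_le_ell_of_le (le_trans (le_trans (le_max_left _ _) (le_max_right _ _)) hD)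
  have hℓ : 0 < ell D := by linarith
  have hℓ1 : 1 ≤ ell D := by linarith
  have hL' : 3 ≤ Real.log D := hL
  have hα := alpha_pos hL
  have hαeq := Section2.alpha_eq_pi_div_ell9 D
  have hcL : c ≤ ‖deriv χ.LFunction 1‖ := h57 D χ hD₀ hq hp hA
  -- `C/𝓛⁶ ≤ 1/2`
  have hC6 : C / ell D ^ 6 ≤ 1 / 2 := by
    have h2C : 2 * C + 1 ≤ ell D := by
      have h : Real.exp (2 * C + 1) ≤ D := le_trans (Nat.le_ceil _)
        (by exact_mod_cast le_trans (le_trans (le_max_right _ _) (le_max_right _ _)) hD)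
      exact (Real.le_log_iff_exp_le (lt_of_lt_of_le (Real.exp_pos _) h)).mpr h
    have h6 : ell D ≤ ell D ^ 6 := by
      calc ell D = ell D ^ 1 := (pow_one _).symm
        _ ≤ ell D ^ 6 := pow_le_pow_right₀ hℓ1 (by norm_num)
    rw [div_le_iff₀ (by positivity)]
    nlinarith
  -- Lemma 5.8 at `s = 1 − β`
  have hA' : ‖χ.LFunction 1‖ ≤ 1 / Real.log D ^ 2022 := le_of_lt hA
  have hKL : 10 * π ≤ Real.log D ^ 8 := by
    have h3 : (3 : ℝ) ^ 8 ≤ Real.log D ^ 8 := pow_le_pow_left₀ (by norm_num) hL' 8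
    nlinarith [Real.pi_lt_four]
  have hs : ‖(1 - β) - 1‖ ≤ 10 * π / Real.log D ^ 9 := by
    rw [sub_sub_cancel_left, norm_neg]
    refine hβu.trans ?_
    rw [hαeq, ell, mul_div_assoc']
    gcongr; norm_num
  have h58 := Lemma58.lemma_5_8_of_le χ hp hL' hA' hKL hs
  rw [sub_sub_cancel_left, ← hC₈] at h58
  -- divide by `|−βL′| ≥ αc/2`
  set L1 : ℂ := deriv χ.LFunction 1 with hL1
  have hden : alpha D / 2 * c ≤ ‖-β * L1‖ := by
    rw [norm_mul, norm_neg]; exact mul_le_mul hβl hcL hc.le (norm_nonneg _)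
  have hdenpos : 0 < ‖-β * L1‖ := lt_of_lt_of_le (by positivity) hden
  have hden0 : -β * L1 ≠ 0 := fun h => by rw [h, norm_zero] at hdenpos; exact lt_irrefl _ hdenpos
  have hratio : ‖χ.LFunction (1 - β) / (-β * L1) - 1‖ ≤ C / ell D ^ 6 := by
    have hrew : χ.LFunction (1 - β) / (-β * L1) - 1 = (χ.LFunction (1 - β) - L1 * -β) / (-β * L1) := by
      rw [div_sub_one hden0]; congr 1; ring
    rw [hrew, norm_div]
    calc ‖χ.LFunction (1 - β) - L1 * -β‖ / ‖-β * L1‖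
        ≤ (C₈ / Real.log D ^ 15) / (alpha D / 2 * c) := div_le_div₀ (by positivity) h58 (by positivity) hden
      _ = C / ell D ^ 6 := by
          rw [hCdef, hαeq, ell]; field_simp
  refine ⟨?_, hratio, hC6⟩
  intro h0
  rw [h0, zero_div, zero_sub, norm_neg, norm_one] at hratio
  linarith

end Literature.NumberTheory.LFunctions.Zhang2022.ResidueValues
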